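import Mathlib

/-!
# Line `aoki-shioda-cm-lift` (crux stmt-KontsevichZagierPeriods-0312) — sorry-free algebraic cores

Strategist de-risking file (planner-cstrat-stmt-KontsevichZagierPeriods-0312-s2-0, 2026-08-17): the
pieces of pure algebra inside stubs S1 and S3 of `Lines/aoki_shioda_cm_lift.lean`, proved outright so
that the stub provers only have to do the KZ book-keeping.

* `trig_ninth` : `sin(2π/9) + sin(4π/9) = 4 sin²(2π/9) sin(4π/9)` (⟸ `cos(2π/3) = -1/2` and
  `Real.cos_three_mul`); `glue_constant`, `rpow_constant`: the glue's constant is the crux's `2·3^{7/6}`.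
* `psi_jacobian` : the POINTWISE Jacobian identity of the Aoki–Shioda substitution in the cube-root
  coordinate `c = (1-u)^{1/3} ∈ (0,1)` (`u = 1 - c³ = (1-c)(1+c+c²)`, `Ψ = (1-c)²/(1+c+c²)`,
  `1 - Ψ = 3c/(1+c+c²)`, `dΨ/du = (1-c²)/(c²(1+c+c²)²)`):
  `Ψ^{-8/9}(1-Ψ)^{-1/3}·dΨ/du = 3^{-1/3}·u^{-7/9}·((1-u)^{-4/9} + (1-u)^{-7/9})`.
-/

noncomputable section

open Real

namespace Summit.KontsevichZagierPeriods.KontsevichZagierPeriods.Cruxes.TriplicationAccessible.AokiShiodaCmLift.Algebra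

/-- `cos(2π/3) = -1/2`. [folklore] -/
theorem cos_two_pi_div_three : Real.cos (2 * π / 3) = -1 / 2 := by
  have h : 2 * π / 3 = π - π / 3 := by ring
  rw [h, Real.cos_pi_sub, Real.cos_pi_div_three]
  norm_num

/-- The cubic satisfied by `cos(2π/9)`: `8cos³(2π/9) - 6cos(2π/9) + 1 = 0`. [folklore] -/
theorem cos_ninth_cubic : 8 * Real.cos (2 * π / 9) ^ 3 - 6 * Real.cos (2 * π / 9) + 1 = 0 := by
  have h3 : Real.cos (3 * (2 * π / 9)) = 4 * Real.cos (2 * π / 9) ^ 3 - 3 * Real.cos (2 * π / 9) :=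
    Real.cos_three_mul _
  have h3' : Real.cos (3 * (2 * π / 9)) = -1 / 2 := by
    rw [show 3 * (2 * π / 9) = 2 * π / 3 by ring]; exact cos_two_pi_div_three
  linarith

theorem sin_two_ninth_pos : 0 < Real.sin (2 * π / 9) :=
  Real.sin_pos_of_pos_of_lt_pi (by positivity) (by nlinarith [Real.pi_pos])

theorem sin_four_ninth_pos : 0 < Real.sin (4 * π / 9) :=
  Real.sin_pos_of_pos_of_lt_pi (by positivity) (by nlinarith [Real.pi_pos])

/-- **`sin(2π/9) + sin(4π/9) = 4 sin²(2π/9) sin(4π/9)`** — the constant identity of the glue S3. [folklore] -/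
theorem trig_ninth :
    Real.sin (2 * π / 9) + Real.sin (4 * π / 9) =
      4 * Real.sin (2 * π / 9) ^ 2 * Real.sin (4 * π / 9) := by
  have h4 : 4 * π / 9 = 2 * (2 * π / 9) := by ring
  rw [h4, Real.sin_two_mul]
  have hc := cos_ninth_cubic
  have hs : Real.sin (2 * π / 9) ^ 2 = 1 - Real.cos (2 * π / 9) ^ 2 := by rw [Real.sin_sq]
  have key : 1 + 2 * Real.cos (2 * π / 9) =
      8 * Real.sin (2 * π / 9) ^ 2 * Real.cos (2 * π / 9) := by
    rw [hs]; linear_combination hc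
  linear_combination Real.sin (2 * π / 9) * key

/-- **The glue constant**: `(√3/(2 sin(2π/9)))·(1/sin(4π/9) + 1/sin(2π/9)) = 2√3`. [folklore] -/
theorem glue_constant :
    Real.sqrt 3 / (2 * Real.sin (2 * π / 9)) * (1 / Real.sin (4 * π / 9) + 1 / Real.sin (2 * π / 9)) =
      2 * Real.sqrt 3 := by
  have h2 := sin_two_ninth_pos
  have h4 := sin_four_ninth_pos
  have key := trig_ninth
  generalize hs2 : Real.sin (2 * π / 9) = s2 at *
  generalize hs4 : Real.sin (4 * π / 9) = s4 at *
  have e : 1 / s4 + 1 / s2 = 4 * s2 := by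
    have : 1 / s4 + 1 / s2 = (s2 + s4) / (s2 * s4) := by
      field_simp
    rw [this, key]
    field_simp
  rw [e]; field_simp; ring

/-- `3^{2/3} · 2√3 = 2·3^{7/6}` (the glue constant times `3^{2/3}` is the crux's `2·3^{7/6}`). [folklore] -/
theorem rpow_constant : (3:ℝ) ^ ((2:ℝ)/3) * (2 * Real.sqrt 3) = 2 * (3:ℝ) ^ ((7:ℝ)/6) := by
  rw [Real.sqrt_eq_rpow, show (7:ℝ)/6 = 2/3 + 1/2 by norm_num,
    Real.rpow_add (by norm_num : (0:ℝ) < 3)]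
  ring

/-- Factoring the sum of the two target kernels in the cube-root coordinate:
`(c³)^{-4/9} + (c³)^{-7/9} = c^{-7/3}·(c+1)` for `c > 0`. [folklore] -/
theorem kernel_sum_factor {c : ℝ} (hc0 : 0 < c) :
    (c ^ 3) ^ (-(4:ℝ)/9) + (c ^ 3) ^ (-(7:ℝ)/9) = c ^ (-(7:ℝ)/3) * (c + 1) := by
  have e2 : (c ^ 3) ^ (-(4:ℝ)/9) = c ^ (-(4:ℝ)/3) := by
    rw [show (c ^ 3 : ℝ) = c ^ (3:ℝ) by norm_cast, ← Real.rpow_mul hc0.le]; norm_num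
  have e3 : (c ^ 3) ^ (-(7:ℝ)/9) = c ^ (-(7:ℝ)/3) := by
    rw [show (c ^ 3 : ℝ) = c ^ (3:ℝ) by norm_cast, ← Real.rpow_mul hc0.le]; norm_num
  rw [e2, e3, mul_add, mul_one, show (-(4:ℝ)/3) = -(7:ℝ)/3 + 1 by norm_num, Real.rpow_add hc0,
    Real.rpow_one]

/-- **Pointwise Jacobian identity of the Aoki–Shioda substitution** in the cube-root coordinate
`c ∈ (0,1)` (`u = 1 - c³ = (1-c)(1+c+c²)`, `1 - u = c³`): with `Ψ = (1-c)²/(1+c+c²)` and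
`dΨ/du = (1-c²)/(c²(1+c+c²)²)`,
`Ψ^{-8/9} (1-Ψ)^{-1/3} dΨ/du = 3^{-1/3} u^{-7/9} ((1-u)^{-4/9} + (1-u)^{-7/9})`. [folklore] -/
theorem psi_jacobian {c : ℝ} (hc0 : 0 < c) (hc1 : c < 1) :
    ((1 - c) ^ 2 / (1 + c + c ^ 2)) ^ (-(8:ℝ)/9) * (1 - (1 - c) ^ 2 / (1 + c + c ^ 2)) ^ (-(1:ℝ)/3) *
        ((1 - c ^ 2) / (c ^ 2 * (1 + c + c ^ 2) ^ 2)) =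
      (3:ℝ) ^ (-(1:ℝ)/3) * ((1 - c) * (1 + c + c ^ 2)) ^ (-(7:ℝ)/9) *
        ((c ^ 3) ^ (-(4:ℝ)/9) + (c ^ 3) ^ (-(7:ℝ)/9)) := by
  have hq : 0 < 1 + c + c ^ 2 := by positivity
  have hd : 0 < 1 - c := by linarith
  have hp : 0 < 1 + c := by linarith
  have h1 : 1 - (1 - c) ^ 2 / (1 + c + c ^ 2) = 3 * c / (1 + c + c ^ 2) := by
    field_simp; ring
  rw [h1, kernel_sum_factor hc0, show (1:ℝ) - c ^ 2 = (1 - c) * (1 + c) by ring]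
  -- both sides are positive: compare logarithms
  have posL : 0 < ((1 - c) ^ 2 / (1 + c + c ^ 2)) ^ (-(8:ℝ)/9) * (3 * c / (1 + c + c ^ 2)) ^ (-(1:ℝ)/3) *
      ((1 - c) * (1 + c) / (c ^ 2 * (1 + c + c ^ 2) ^ 2)) := by positivity
  have posR : 0 < (3:ℝ) ^ (-(1:ℝ)/3) * ((1 - c) * (1 + c + c ^ 2)) ^ (-(7:ℝ)/9) *
      (c ^ (-(7:ℝ)/3) * (c + 1)) := by positivity
  refine Real.log_injOn_pos (Set.mem_Ioi.2 posL) (Set.mem_Ioi.2 posR) ?_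
  have hdne : (1 - c) ≠ 0 := hd.ne'
  have hqne : (1 + c + c ^ 2) ≠ 0 := hq.ne'
  have hcne : c ≠ 0 := hc0.ne'
  have hpne : (1 + c) ≠ 0 := hp.ne'
  have hpne' : (c + 1) ≠ 0 := by rw [add_comm]; exact hpne
  have h3 : (0:ℝ) < 3 := by norm_num
  -- the atoms of the left-hand side
  have hA : 0 < (1 - c) ^ 2 / (1 + c + c ^ 2) := div_pos (pow_pos hd 2) hq
  have hB : 0 < 3 * c / (1 + c + c ^ 2) := div_pos (mul_pos h3 hc0) hq
  have hC : 0 < (1 - c) * (1 + c) / (c ^ 2 * (1 + c + c ^ 2) ^ 2) :=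
    div_pos (mul_pos hd hp) (mul_pos (pow_pos hc0 2) (pow_pos hq 2))
  have hAa : ((1 - c) ^ 2 / (1 + c + c ^ 2)) ^ (-(8:ℝ)/9) ≠ 0 := (Real.rpow_pos_of_pos hA _).ne'
  have hBb : (3 * c / (1 + c + c ^ 2)) ^ (-(1:ℝ)/3) ≠ 0 := (Real.rpow_pos_of_pos hB _).ne'
  rw [Real.log_mul (mul_ne_zero hAa hBb) hC.ne', Real.log_mul hAa hBb, Real.log_rpow hA,
    Real.log_rpow hB, Real.log_div (pow_pos hd 2).ne' hqne, Real.log_pow,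
    Real.log_div (mul_pos h3 hc0).ne' hqne, Real.log_mul h3.ne' hcne,
    Real.log_div (mul_pos hd hp).ne' (mul_pos (pow_pos hc0 2) (pow_pos hq 2)).ne',
    Real.log_mul hdne hpne, Real.log_mul (pow_pos hc0 2).ne' (pow_pos hq 2).ne', Real.log_pow,
    Real.log_pow]
  -- the atoms of the right-hand side
  have hT : (3:ℝ) ^ (-(1:ℝ)/3) ≠ 0 := (Real.rpow_pos_of_pos h3 _).ne'
  have hS : ((1 - c) * (1 + c + c ^ 2)) ^ (-(7:ℝ)/9) ≠ 0 := (Real.rpow_pos_of_pos (mul_pos hd hq) _).ne'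
  have hE : c ^ (-(7:ℝ)/3) ≠ 0 := (Real.rpow_pos_of_pos hc0 _).ne'
  rw [Real.log_mul (mul_ne_zero hT hS) (mul_ne_zero hE hpne'), Real.log_mul hT hS,
    Real.log_mul hE hpne', Real.log_rpow h3, Real.log_rpow (mul_pos hd hq), Real.log_mul hdne hqne,
    Real.log_rpow hc0, show c + 1 = 1 + c from add_comm c 1]
  push_cast
  ring

/-! ## The substitution in the original coordinate `u ∈ (0,1)` -/

/-- The cube-root coordinate: for `u ∈ (0,1)`, `c = (1-u)^{1/3}` lies in `(0,1)` and `c³ = 1 - u`,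
`u = (1-c)(1+c+c²)`. [folklore] -/
theorem cubeRoot_facts {u : ℝ} (hu0 : 0 < u) (hu1 : u < 1) :
    0 < (1 - u) ^ ((1:ℝ)/3) ∧ (1 - u) ^ ((1:ℝ)/3) < 1 ∧ ((1 - u) ^ ((1:ℝ)/3)) ^ 3 = 1 - u ∧
      u = (1 - (1 - u) ^ ((1:ℝ)/3)) * (1 + (1 - u) ^ ((1:ℝ)/3) + ((1 - u) ^ ((1:ℝ)/3)) ^ 2) := by
  have h1u : 0 < 1 - u := by linarith
  have hc0 : 0 < (1 - u) ^ ((1:ℝ)/3) := Real.rpow_pos_of_pos h1u _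
  have hc3 : ((1 - u) ^ ((1:ℝ)/3)) ^ 3 = 1 - u := by
    rw [show (((1 - u) ^ ((1:ℝ)/3)) ^ 3 : ℝ) = ((1 - u) ^ ((1:ℝ)/3)) ^ (3:ℝ) by norm_cast,
      ← Real.rpow_mul h1u.le]
    norm_num
  have hc1 : (1 - u) ^ ((1:ℝ)/3) < 1 := by
    calc (1 - u) ^ ((1:ℝ)/3) < (1:ℝ) ^ ((1:ℝ)/3) :=
          Real.rpow_lt_rpow h1u.le (by linarith) (by norm_num)
      _ = 1 := Real.one_rpow _
  refine ⟨hc0, hc1, hc3, ?_⟩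
  linear_combination hc3

/-- `Ψ(u) = (1 - (1-u)^{1/3})³/u = (1-c)²/(1+c+c²)` with `c = (1-u)^{1/3}`. [folklore] -/
theorem psi_eq {u : ℝ} (hu0 : 0 < u) (hu1 : u < 1) :
    (1 - (1 - u) ^ ((1:ℝ)/3)) ^ 3 / u =
      (1 - (1 - u) ^ ((1:ℝ)/3)) ^ 2 / (1 + (1 - u) ^ ((1:ℝ)/3) + ((1 - u) ^ ((1:ℝ)/3)) ^ 2) := by
  obtain ⟨hc0, hc1, hc3, hu⟩ := cubeRoot_facts hu0 hu1
  set c := (1 - u) ^ ((1:ℝ)/3) with hc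
  have hq : 0 < 1 + c + c ^ 2 := by positivity
  have hd : (1 - c) ≠ 0 := by linarith
  rw [div_eq_div_iff hu0.ne' hq.ne', hu]
  ring

/-- **The pointwise kernel identity of stub S1 in the coordinate `u`**: with `c = (1-u)^{1/3}`,
`Ψ = (1-c)²/(1+c+c²)` (`= (1-(1-u)^{1/3})³/u`) and `Ψ' = (1-c²)/(c²(1+c+c²)²)`,
`Ψ^{-8/9}(1-Ψ)^{-1/3}Ψ' = 3^{-1/3}(u^{-7/9}(1-u)^{-4/9} + u^{-7/9}(1-u)^{-7/9})` — literally the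
right-hand integrand of `stub_aokiShiodaSixteen`. [folklore] -/
theorem psi_jacobian_u {u : ℝ} (hu0 : 0 < u) (hu1 : u < 1) :
    ((1 - (1 - u) ^ ((1:ℝ)/3)) ^ 2 / (1 + (1 - u) ^ ((1:ℝ)/3) + ((1 - u) ^ ((1:ℝ)/3)) ^ 2)) ^ (-(8:ℝ)/9) *
      (1 - (1 - (1 - u) ^ ((1:ℝ)/3)) ^ 2 / (1 + (1 - u) ^ ((1:ℝ)/3) + ((1 - u) ^ ((1:ℝ)/3)) ^ 2)) ^ (-(1:ℝ)/3) *
      ((1 - ((1 - u) ^ ((1:ℝ)/3)) ^ 2) /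
        (((1 - u) ^ ((1:ℝ)/3)) ^ 2 * (1 + (1 - u) ^ ((1:ℝ)/3) + ((1 - u) ^ ((1:ℝ)/3)) ^ 2) ^ 2)) =
      (3:ℝ) ^ (-(1:ℝ)/3) * (u ^ (-(7:ℝ)/9) * (1 - u) ^ (-(4:ℝ)/9) + u ^ (-(7:ℝ)/9) * (1 - u) ^ (-(7:ℝ)/9)) := by
  obtain ⟨hc0, hc1, hc3, hu⟩ := cubeRoot_facts hu0 hu1
  rw [psi_jacobian hc0 hc1, ← hu, hc3]
  ring

/-- **`Ψ` is differentiable on `(0,1)` with the derivative used above**: with `c = (1-u)^{1/3}`,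
`d/du [(1-c)²/(1+c+c²)] = (1-c²)/(c²(1+c+c²)²)`. [folklore] -/
theorem hasDerivAt_psi {u : ℝ} (hu0 : 0 < u) (hu1 : u < 1) :
    HasDerivAt (fun v : ℝ => (1 - (1 - v) ^ ((1:ℝ)/3)) ^ 2 / (1 + (1 - v) ^ ((1:ℝ)/3) + ((1 - v) ^ ((1:ℝ)/3)) ^ 2))
      ((1 - ((1 - u) ^ ((1:ℝ)/3)) ^ 2) /
        (((1 - u) ^ ((1:ℝ)/3)) ^ 2 * (1 + (1 - u) ^ ((1:ℝ)/3) + ((1 - u) ^ ((1:ℝ)/3)) ^ 2) ^ 2)) u := by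
  obtain ⟨hc0, hc1, hc3, hu⟩ := cubeRoot_facts hu0 hu1
  have h1u : 0 < 1 - u := by linarith
  -- the inner map v ↦ (1-v)^{1/3}
  have hg : HasDerivAt (fun v : ℝ => (1 - v) ^ ((1:ℝ)/3))
      ((-1) * ((1:ℝ)/3) * (1 - u) ^ ((1:ℝ)/3 - 1)) u :=
    ((hasDerivAt_id u).const_sub 1).rpow_const (Or.inl h1u.ne')
  -- the outer rational map c ↦ (1-c)²/(1+c+c²)
  set c := (1 - u) ^ ((1:ℝ)/3) with hc
  have hq : 0 < 1 + c + c ^ 2 := by positivity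
  have hΦ : HasDerivAt (fun x : ℝ => (1 - x) ^ 2 / (1 + x + x ^ 2))
      ((↑(2:ℕ) * (1 - c) ^ (2 - 1) * (-1) * (1 + c + c ^ 2) - (1 - c) ^ 2 * (1 + 2 * c)) /
        (1 + c + c ^ 2) ^ 2) c := by
    have h1 : HasDerivAt (fun x : ℝ => (1 - x) ^ 2) (↑(2:ℕ) * (1 - c) ^ (2 - 1) * (-1)) c :=
      ((hasDerivAt_id c).const_sub 1).pow 2
    have h2 : HasDerivAt (fun x : ℝ => 1 + x + x ^ 2) (1 + 2 * c) c := by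
      have ha : HasDerivAt (fun x : ℝ => 1 + x) 1 c := (hasDerivAt_id' c).const_add 1
      have hb : HasDerivAt (fun x : ℝ => x ^ 2) (↑(2:ℕ) * c ^ (2 - 1) * 1) c :=
        (hasDerivAt_id' c).pow 2
      refine (ha.add hb).congr_deriv ?_
      push_cast
      ring
    exact h1.div h2 hq.ne'
  have hcomp := hΦ.comp u hg
  -- (1-u)^{1/3 - 1} = 1/c²
  have hpow : (1 - u) ^ ((1:ℝ)/3 - 1) = (c ^ 2)⁻¹ := by
    rw [show ((1:ℝ)/3 - 1) = ((1:ℝ)/3) * (-2) by norm_num, Real.rpow_mul h1u.le, ← hc,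
      Real.rpow_neg hc0.le, show ((2:ℝ)) = ((2:ℕ):ℝ) by norm_num, Real.rpow_natCast]
  have hcne : c ≠ 0 := hc0.ne'
  have hqne : (1 + c + c ^ 2) ≠ 0 := hq.ne'
  refine hcomp.congr_deriv ?_
  rw [hpow]
  field_simp
  ring

/-- `Ψ' > 0` on `(0,1)` (so `Ψ` is strictly increasing, hence injective: `strictMonoOn_of_deriv_pos`). [folklore] -/
theorem psi_deriv_pos {u : ℝ} (hu0 : 0 < u) (hu1 : u < 1) :
    0 < (1 - ((1 - u) ^ ((1:ℝ)/3)) ^ 2) /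
        (((1 - u) ^ ((1:ℝ)/3)) ^ 2 * (1 + (1 - u) ^ ((1:ℝ)/3) + ((1 - u) ^ ((1:ℝ)/3)) ^ 2) ^ 2) := by
  obtain ⟨hc0, hc1, -, -⟩ := cubeRoot_facts hu0 hu1
  set c := (1 - u) ^ ((1:ℝ)/3)
  have h1 : 0 < 1 - c ^ 2 := by nlinarith
  positivity

/-- `Ψ(u) ∈ (0,1)` for `u ∈ (0,1)` (maps the open unit interval into itself). [folklore] -/
theorem psi_mem_Ioo {u : ℝ} (hu0 : 0 < u) (hu1 : u < 1) :
    (1 - (1 - u) ^ ((1:ℝ)/3)) ^ 2 / (1 + (1 - u) ^ ((1:ℝ)/3) + ((1 - u) ^ ((1:ℝ)/3)) ^ 2) ∈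
      Set.Ioo (0:ℝ) 1 := by
  obtain ⟨hc0, hc1, -, -⟩ := cubeRoot_facts hu0 hu1
  set c := (1 - u) ^ ((1:ℝ)/3)
  have hq : 0 < 1 + c + c ^ 2 := by positivity
  have hd : 0 < 1 - c := by linarith
  refine ⟨div_pos (pow_pos hd 2) hq, ?_⟩
  rw [div_lt_one hq]
  nlinarith

end Summit.KontsevichZagierPeriods.KontsevichZagierPeriods.Cruxes.TriplicationAccessible.AokiShiodaCmLift.Algebra
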